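import Summits.AtomisticToContinuum.FouriersLaw.Theorems.OddSectorIrreversibilityConeScaleCorrectorStubConeTransportBudgetContraction
import Summits.AtomisticToContinuum.FouriersLaw.Theorems.OddSectorIrreversibilitySubBallisticWindowGibbsPoincare
import Summits.AtomisticToContinuum.FouriersLaw.Theorems.OddSectorIrreversibilitySubBallisticWindowGibbsMoments
import Summits.AtomisticToContinuum.FouriersLaw.Theorems.OddSectorIrreversibilitySubBallisticWindowStaticCurrentBound
import Summits.AtomisticToContinuum.FouriersLaw.Theorems.OddResponseBound.Negative.OddPairing

/-!
# `ConeScaleCorrector` (E1), line `GlueInnerCone`: the rigorous part of stub C1 `stub_coneTransportBudget`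

Support file for crux stmt-AtomisticToContinuum-14069
(`Summit.AtomisticToContinuum.FouriersLaw.Theses.OddSectorIrreversibility.ConeScaleCorrector`), line
`GlueInnerCone`, registered stub C1 `stub_coneTransportBudget`: the `N`-UNIFORM Einstein–Helfand budget
`∫ (u_τ)² dμ_T ≤ C·N·(1+τ)·Z` for the finite-horizon Kubo correctors
`u_τ(x) = ∫_{(0,τ]} P_tJ_tot(x) dt` of the OPEN equilibrium pinned anharmonic chain
(`pinnedChain ω₂ lam β γ`, both Langevin baths at `T`; `μ_T = e^{-H/T}·Lebesgue` =
`OddSectorLocality.gibbsWeight`, `Z = ∫ e^{-H/T}`, `P_tJ_tot = OddSectorLocality.currentForecast … t`,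
`A_N = forecastNormSq`, `M_N = currentNormSq`).

C1 itself — linear growth in `τ` uniformly in `N` — is the `N`-uniform integrability of the total-current
autocorrelation of the open anharmonic chain, for which the tree has no supplier (it contains the dead stub (B)
`stub_finiteHorizonBudget` of line `one-crossing-echo-contraction`). On top of the contraction file
(`…StubConeTransportBudgetContraction`: `A_N(t) ≤ M_N`, `A_N` antitone and measurable, joint integrability of the
forecast) this file lands what IS rigorous and `N`-uniform:

* (b) `integral_sq_setIntegral_Ioc_le` (abstract) and `integral_sq_horizonCorrector_le_mul_setIntegral` — Jensen in
  time then Fubini: `∫ (u_τ)² dμ_T ≤ τ · ∫_{(0,τ]} A_N(t) dt` (`τ ≥ 0`); `setIntegral_forecastNormSq_le`,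
  `integral_sq_horizonCorrector_le_sq_mul` — hence `∫ (u_τ)² dμ_T ≤ τ² M_N`;
* (c) `exists_const_currentNormSq_le` — the static Gibbs bound `M_N ≤ K·N·Z` for ALL `N`
  (Brascamp–Lieb Poincaré `stub_gibbsPoincare` ⟹ `N`-uniform moments `stub_gibbsMoments` ⟹ block-current statics
  `stub_staticCurrentBound`, block `[0, N)`);
* (d) `exists_const_integral_sq_horizonCorrector_le` — the honest `N`-uniform budget
  `∫ (u_τ)² dμ_T ≤ K·N·τ²·Z` (one power of `τ` short of C1 — exactly the harmonic/ballistic exponent), restated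
  closed as the registered sub-goal `stub_coneTransportBudget_sqHorizon` of the item, and
  `coneTransportBudget_of_le` — C1 VERBATIM on bounded horizons `τ ≤ τ₀` (constant `K·max(τ₀,1)`).

Nothing here closes the crux; the registered signature of C1 (all horizons) is not proved.
-/

noncomputable section

open MeasureTheory ProbabilityTheory Filter Topology Set
open scoped ENNReal NNReal BigOperators
open Literature.MathematicalPhysics.KineticTheory.HeatConduction
open Literature.MathematicalPhysics.KineticTheory.OddSectorLocality

namespace Summit.AtomisticToContinuum.FouriersLaw.Theorems.OddSectorIrreversibility

open Summit.AtomisticToContinuum.FouriersLaw.Theorems.LightConeBondHeat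
open Summit.AtomisticToContinuum.FouriersLaw.Theorems.SubdiffusiveBondHeat
open Summit.AtomisticToContinuum.FouriersLaw.Theorems.OddResponseBound.Negative.OddPairing

variable {N : ℕ} {ω₂ lam β γ T : ℝ}

/-! ### (b) Jensen in time, then Fubini -/

/-- **Jensen in time, then Fubini** (abstract form). For an s-finite measure `μ`, `τ ≥ 0` and `G` jointly
integrable with jointly integrable square on `μ ⊗ Lebesgue|_{(0,τ]}`:
`∫ (∫_{(0,τ]} G(x,t) dt)² dμ(x) ≤ τ · ∫_{(0,τ]} (∫ G(x,t)² dμ(x)) dt`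
(Cauchy–Schwarz against `1` on `(0,τ]` for a.e. `x`, then swap the integrals). [folklore] -/
theorem integral_sq_setIntegral_Ioc_le {X : Type*} [MeasurableSpace X] (μ : Measure X) [SFinite μ]
    {G : X → ℝ → ℝ} {τ : ℝ} (hτ : 0 ≤ τ)
    (hG : Integrable (Function.uncurry G) (μ.prod (volume.restrict (Ioc (0 : ℝ) τ))))
    (hG2 : Integrable (Function.uncurry fun x t => (G x t) ^ 2) (μ.prod (volume.restrict (Ioc (0 : ℝ) τ)))) :
    ∫ x, (∫ t in Ioc (0 : ℝ) τ, G x t) ^ 2 ∂μ ≤ τ * ∫ t in Ioc (0 : ℝ) τ, (∫ x, (G x t) ^ 2 ∂μ) := by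
  have hν1 : (volume.restrict (Ioc (0 : ℝ) τ)).real univ = τ := by
    rw [measureReal_restrict_apply_univ, Real.volume_real_Ioc_of_le hτ, sub_zero]
  have hae : ∀ᵐ x ∂μ, (∫ t in Ioc (0 : ℝ) τ, G x t) ^ 2 ≤ τ * ∫ t in Ioc (0 : ℝ) τ, (G x t) ^ 2 := by
    filter_upwards [hG.prod_right_ae, hG2.prod_right_ae] with x h1 h2
    have hmem : MemLp (fun t => G x t) 2 (volume.restrict (Ioc (0 : ℝ) τ)) :=
      (memLp_two_iff_integrable_sq h1.aestronglyMeasurable).2 h2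
    have h := sq_integral_mul_le (memLp_const (1 : ℝ)) hmem
    simp only [one_mul, one_pow, integral_const, smul_eq_mul, mul_one, hν1] at h
    exact h
  have hint : Integrable (fun x => τ * ∫ t in Ioc (0 : ℝ) τ, (G x t) ^ 2) μ :=
    (hG2.integral_prod_left).const_mul τ
  calc ∫ x, (∫ t in Ioc (0 : ℝ) τ, G x t) ^ 2 ∂μ
      ≤ ∫ x, τ * (∫ t in Ioc (0 : ℝ) τ, (G x t) ^ 2) ∂μ :=
        integral_mono_of_nonneg (Eventually.of_forall fun x => sq_nonneg _) hint hae
    _ = τ * ∫ x, (∫ t in Ioc (0 : ℝ) τ, (G x t) ^ 2) ∂μ := integral_const_mul _ _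
    _ = τ * ∫ t in Ioc (0 : ℝ) τ, (∫ x, (G x t) ^ 2 ∂μ) := by
        congr 1
        exact integral_integral_swap hG2

/-- Joint integrability of the total-current forecast and of its square on `μ_T ⊗ Lebesgue|_{(0,τ]}`
(every `N`; for `N = 0` the forecast vanishes). [folklore] -/
theorem integrable_currentForecast_prod_Ioc (hω : 0 < ω₂) (hl : 0 ≤ lam) (hβ : 0 < β) (hγ : 0 < γ) (hT : 0 < T)
    (N : ℕ) (τ : ℝ) :
    Integrable (Function.uncurry fun (x : PhaseSpace N) (t : ℝ) => currentForecast ω₂ lam β γ T N t x)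
        ((gibbsWeight ω₂ lam β γ T N).prod (volume.restrict (Ioc (0 : ℝ) τ))) ∧
      Integrable (Function.uncurry fun (x : PhaseSpace N) (t : ℝ) => (currentForecast ω₂ lam β γ T N t x) ^ 2)
        ((gibbsWeight ω₂ lam β γ T N).prod (volume.restrict (Ioc (0 : ℝ) τ))) := by
  have hZtop := (pinnedChain ω₂ lam β γ).partitionFunction_ne_top
    (pinnedChain_integrable_gibbsDensity hω hl hβ.le γ N hT)
  rw [gibbsWeight_eq_smul_gibbsMeasure hω hl hβ.le γ N hT, Measure.prod_smul_left]
  rcases Nat.eq_zero_or_pos N with rfl | hN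
  · have h0 : ∀ (t : ℝ) (x : PhaseSpace 0), currentForecast ω₂ lam β γ T 0 t x = 0 := fun t x => by
      simp only [currentForecast, Finset.univ_eq_empty, Finset.sum_empty, integral_zero]
    simp only [Function.uncurry_def, h0]
    norm_num
  · obtain ⟨hϑ0, h2ϑ⟩ := quarter_inv_temp_admissible hT
    have hϑ1 : 1 / (4 * T) < 1 / T := by linarith
    obtain ⟨K, c, hK, hc, hb⟩ := pinnedChain_harris_bound hω hl hβ hγ hN hT hϑ0 hϑ1
    have hJc := continuous_totalBondCurrent ω₂ lam β γ N
    have hJb := abs_totalBondCurrent_le_exp hω.le hl hβ.le γ N hϑ0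
    have hJ0 := integral_totalBondCurrent_gibbsMeasure hω hl hβ.le γ N hT
    have hC : (0 : ℝ) ≤ N * (N * ((3 + β) / 2) * (2 * Real.exp (1 / (4 * T)) / (1 / (4 * T)) ^ 2)) := by
      have := hβ.le
      positivity
    exact ⟨(centred_integrable_act_prod_Ioc hK.le hb hc hJc hC hJb hJ0 hω hl hβ.le hγ.le hT hϑ1 τ).smul_measure hZtop,
      (centred_integrable_sq_act_prod_Ioc hK.le hb hc hJc hC hJb hJ0 hω hl hβ.le hγ.le hT h2ϑ τ).smul_measure hZtop⟩

/-- **(b) `integral_sq_horizonCorrector_le_mul_setIntegral`** — Jensen in time then Fubini, fixed `N`: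
`∫ (u_τ)² dμ_T ≤ τ · ∫_{(0,τ]} A_N(t) dt` for `τ ≥ 0`, `u_τ = ∫_{(0,τ]} P_tJ_tot dt`,
`A_N(t) = ‖P_tJ_tot‖²_{L²(μ_T)}`. [folklore] -/
theorem integral_sq_horizonCorrector_le_mul_setIntegral (hω : 0 < ω₂) (hl : 0 ≤ lam) (hβ : 0 < β) (hγ : 0 < γ)
    (hT : 0 < T) (N : ℕ) {τ : ℝ} (hτ : 0 ≤ τ) :
    ∫ x, (∫ t in Ioc (0 : ℝ) τ, currentForecast ω₂ lam β γ T N t x) ^ 2 ∂(gibbsWeight ω₂ lam β γ T N) ≤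
      τ * ∫ t in Ioc (0 : ℝ) τ, forecastNormSq ω₂ lam β γ T N t := by
  haveI := sFinite_gibbsWeight ω₂ lam β γ T N
  obtain ⟨h1, h2⟩ := integrable_currentForecast_prod_Ioc hω hl hβ hγ hT N τ
  exact integral_sq_setIntegral_Ioc_le (gibbsWeight ω₂ lam β γ T N) hτ h1 h2

/-- `∫_{(0,τ]} A_N(t) dt ≤ τ · M_N` for `τ ≥ 0` (the contraction (a) integrated in time). [folklore] -/
theorem setIntegral_forecastNormSq_le (hω : 0 < ω₂) (hl : 0 ≤ lam) (hβ : 0 < β) (hγ : 0 < γ) (hT : 0 < T)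
    (N : ℕ) {τ : ℝ} (hτ : 0 ≤ τ) :
    ∫ t in Ioc (0 : ℝ) τ, forecastNormSq ω₂ lam β γ T N t ≤ τ * currentNormSq ω₂ lam β γ T N := by
  have hν1 : (volume.restrict (Ioc (0 : ℝ) τ)).real univ = τ := by
    rw [measureReal_restrict_apply_univ, Real.volume_real_Ioc_of_le hτ, sub_zero]
  calc ∫ t in Ioc (0 : ℝ) τ, forecastNormSq ω₂ lam β γ T N t
      ≤ ∫ _t in Ioc (0 : ℝ) τ, currentNormSq ω₂ lam β γ T N :=
        integral_mono_of_nonneg (Eventually.of_forall fun t => forecastNormSq_nonneg ω₂ lam β γ T N t)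
          (integrable_const _) (Eventually.of_forall fun t => forecastNormSq_le_currentNormSq hω hl hβ hγ hT N t)
    _ = τ * currentNormSq ω₂ lam β γ T N := by rw [integral_const, smul_eq_mul, hν1]

/-- **(b') `integral_sq_horizonCorrector_le_sq_mul`** — the Minkowski/Cauchy–Schwarz-in-time budget at fixed
`N`: `∫ (u_τ)² dμ_T ≤ τ² · M_N` for `τ ≥ 0`. [folklore] -/
theorem integral_sq_horizonCorrector_le_sq_mul (hω : 0 < ω₂) (hl : 0 ≤ lam) (hβ : 0 < β) (hγ : 0 < γ)
    (hT : 0 < T) (N : ℕ) {τ : ℝ} (hτ : 0 ≤ τ) :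
    ∫ x, (∫ t in Ioc (0 : ℝ) τ, currentForecast ω₂ lam β γ T N t x) ^ 2 ∂(gibbsWeight ω₂ lam β γ T N) ≤
      τ ^ 2 * currentNormSq ω₂ lam β γ T N := by
  calc _ ≤ τ * ∫ t in Ioc (0 : ℝ) τ, forecastNormSq ω₂ lam β γ T N t :=
        integral_sq_horizonCorrector_le_mul_setIntegral hω hl hβ hγ hT N hτ
    _ ≤ τ * (τ * currentNormSq ω₂ lam β γ T N) :=
        mul_le_mul_of_nonneg_left (setIntegral_forecastNormSq_le hω hl hβ hγ hT N hτ) hτ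
    _ = τ ^ 2 * currentNormSq ω₂ lam β γ T N := by ring

/-! ### (c) The static Gibbs bound `M_N ≤ K·N·Z`, uniformly in `N` -/

/-- **(c) `exists_const_currentNormSq_le`** — `N`-uniform statics of the total current: there is `K ≥ 0`
(depending on `ω₂, lam, β, T`) with `M_N = ∫ J_tot² dμ_T ≤ K·N·Z` for ALL `N` (`Z = ∫ e^{-H/T}`). Chain of the
tree's landed `SubBallisticWindow` statics: Brascamp–Lieb Poincaré (`stub_gibbsPoincare`) ⟹ `N`-uniform
coordinate moments (`stub_gibbsMoments`) ⟹ block-current bound (`stub_staticCurrentBound`) on the block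
`[0, N)`, which is the total current. [folklore] -/
theorem exists_const_currentNormSq_le (hω : 0 < ω₂) (hl : 0 ≤ lam) (hβ : 0 ≤ β) (γ : ℝ) (hT : 0 < T) :
    ∃ K : ℝ, 0 ≤ K ∧ ∀ N : ℕ, currentNormSq ω₂ lam β γ T N ≤
      K * N * ∫ x, Real.exp (-((pinnedChain ω₂ lam β γ).hamiltonian N x) / T) := by
  have hP := SubBallisticWindow.GibbsPoincare.stub_gibbsPoincare ω₂ lam β γ hω hl hβ T hT
  have hM := SubBallisticWindow.GibbsMoments.stub_gibbsMoments ω₂ lam β γ hω hl hβ T hT hP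
  obtain ⟨C, hC⟩ := SubBallisticWindow.StaticCurrentBound.stub_staticCurrentBound ω₂ lam β γ hω hl hβ T hT hM
  refine ⟨max C 0, le_max_right _ _, fun N => ?_⟩
  have hZ0 : 0 ≤ ∫ x, Real.exp (-((pinnedChain ω₂ lam β γ).hamiltonian N x) / T) :=
    integral_nonneg fun _ => (Real.exp_pos _).le
  have hsum : ∀ z : PhaseSpace N,
      (∑ i : Fin N, (if 0 ≤ i.val ∧ i.val < N then (pinnedChain ω₂ lam β γ).bondCurrent N i z else 0)) =
        ∑ i : Fin N, (pinnedChain ω₂ lam β γ).bondCurrent N i z :=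
    fun z => Finset.sum_congr rfl fun i _ => if_pos ⟨Nat.zero_le _, i.isLt⟩
  have h := hC N 0 N (Nat.zero_le N)
  simp only [hsum, Nat.cast_zero, sub_zero] at h
  calc currentNormSq ω₂ lam β γ T N
      ≤ C * N * ∫ x, Real.exp (-((pinnedChain ω₂ lam β γ).hamiltonian N x) / T) := h
    _ ≤ max C 0 * N * ∫ x, Real.exp (-((pinnedChain ω₂ lam β γ).hamiltonian N x) / T) :=
        mul_le_mul_of_nonneg_right (mul_le_mul_of_nonneg_right (le_max_left _ _) (Nat.cast_nonneg N)) hZ0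

/-! ### (d) The honest `N`-uniform budget and C1 on bounded horizons -/

/-- **(d) `exists_const_integral_sq_horizonCorrector_le`** — the honest `N`-uniform Einstein–Helfand budget of
the finite-horizon correctors of the OPEN chain: there is `K ≥ 0` (depending on `ω₂, lam, β, T` only) with
`∫ (∫_{(0,τ]} P_tJ_tot dt)² dμ_T ≤ K·N·τ²·Z` for every `N` and every `τ ≥ 0` — (b') and (c). One power of
`τ` short of C1 (`K·N·(1+τ)·Z`), which is exactly the harmonic (ballistic) exponent. [folklore] -/
theorem exists_const_integral_sq_horizonCorrector_le (hω : 0 < ω₂) (hl : 0 ≤ lam) (hβ : 0 < β) (hγ : 0 < γ)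
    (hT : 0 < T) :
    ∃ K : ℝ, 0 ≤ K ∧ ∀ (N : ℕ) (τ : ℝ), 0 ≤ τ →
      ∫ x, (∫ t in Ioc (0 : ℝ) τ, currentForecast ω₂ lam β γ T N t x) ^ 2 ∂(gibbsWeight ω₂ lam β γ T N) ≤
        K * N * τ ^ 2 * ∫ x, Real.exp (-((pinnedChain ω₂ lam β γ).hamiltonian N x) / T) := by
  obtain ⟨K, hK0, hK⟩ := exists_const_currentNormSq_le hω hl hβ.le γ hT
  refine ⟨K, hK0, fun N τ hτ => ?_⟩
  calc _ ≤ τ ^ 2 * currentNormSq ω₂ lam β γ T N := integral_sq_horizonCorrector_le_sq_mul hω hl hβ hγ hT N hτ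
    _ ≤ τ ^ 2 * (K * N * ∫ x, Real.exp (-((pinnedChain ω₂ lam β γ).hamiltonian N x) / T)) :=
        mul_le_mul_of_nonneg_left (hK N) (sq_nonneg τ)
    _ = _ := by ring

/-- **C1 on bounded horizons** (`coneTransportBudget_of_le`): for every `τ₀` there is `C` with
`∫ (∫_{(0,τ]} P_tJ_tot dt)² dμ_T ≤ C·N·(1+τ)·Z` for all `N` and all `0 ≤ τ ≤ τ₀` — the registered signature of
`stub_coneTransportBudget` restricted to `τ ≤ τ₀` (`K·N·τ²·Z ≤ K·max(τ₀,1)·N·(1+τ)·Z`). The unrestricted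
statement (linear growth in `τ` uniformly in `N`) is the open `N`-uniform integrability of the total-current
autocorrelation of the open anharmonic chain and is NOT proved here. [folklore] -/
theorem coneTransportBudget_of_le (hω : 0 < ω₂) (hl : 0 ≤ lam) (hβ : 0 < β) (hγ : 0 < γ) (hT : 0 < T)
    (τ₀ : ℝ) :
    ∃ C : ℝ, 0 ≤ C ∧ ∀ (N : ℕ) (τ : ℝ), 0 ≤ τ → τ ≤ τ₀ →
      ∫ x, (∫ t in Set.Ioc (0 : ℝ) τ, currentForecast ω₂ lam β γ T N t x) ^ 2 ∂(gibbsWeight ω₂ lam β γ T N) ≤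
        C * (N : ℝ) * (1 + τ) *
          ∫ x, Real.exp (-((pinnedChain ω₂ lam β γ).hamiltonian N x) / T) ∂volume := by
  obtain ⟨K, hK0, hK⟩ := exists_const_integral_sq_horizonCorrector_le hω hl hβ hγ hT
  refine ⟨K * max τ₀ 1, mul_nonneg hK0 (le_trans zero_le_one (le_max_right _ _)), fun N τ hτ hττ₀ => ?_⟩
  have hZ0 : 0 ≤ ∫ x, Real.exp (-((pinnedChain ω₂ lam β γ).hamiltonian N x) / T) :=
    integral_nonneg fun _ => (Real.exp_pos _).le
  have hN0 : (0 : ℝ) ≤ N := Nat.cast_nonneg N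
  have h1 : τ ^ 2 ≤ max τ₀ 1 * (1 + τ) := by
    have hm : τ ≤ max τ₀ 1 := hττ₀.trans (le_max_left _ _)
    have hm0 : 0 ≤ max τ₀ 1 := le_trans zero_le_one (le_max_right _ _)
    nlinarith [mul_le_mul_of_nonneg_left hm hτ, mul_nonneg hm0 hτ]
  calc _ ≤ K * N * τ ^ 2 * ∫ x, Real.exp (-((pinnedChain ω₂ lam β γ).hamiltonian N x) / T) := hK N τ hτ
    _ ≤ K * N * (max τ₀ 1 * (1 + τ)) * ∫ x, Real.exp (-((pinnedChain ω₂ lam β γ).hamiltonian N x) / T) :=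
        mul_le_mul_of_nonneg_right (mul_le_mul_of_nonneg_left h1 (mul_nonneg hK0 hN0)) hZ0
    _ = K * max τ₀ 1 * (N : ℝ) * (1 + τ) *
          ∫ x, Real.exp (-((pinnedChain ω₂ lam β γ).hamiltonian N x) / T) := by ring


/-! ### The registered sub-goal of C1 proved by this file -/

/-- **Sub-goal `stub_coneTransportBudget_sqHorizon` of C1** (registered on stmt-AtomisticToContinuum-14069;
`N`-uniform): the honest Einstein–Helfand budget of the finite-horizon Kubo correctors of the OPEN chain,
`∫ (∫_{(0,τ]} P_tJ_tot dt)² dμ_T ≤ K·N·τ²·Z` for every `N` and every `τ ≥ 0`, with `K` depending on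
`ω₂, lam, β, T` only (`exists_const_integral_sq_horizonCorrector_le`: Jensen in time + Fubini + contraction + the
`N`-uniform statics `M_N ≤ K·N·Z`). C1 = the same with `τ²` replaced by `1 + τ`. [folklore] -/
theorem stub_coneTransportBudget_sqHorizon :
    ∀ ω₂ lam β γ : ℝ, 0 < ω₂ → 0 ≤ lam → 0 < β → 0 < γ → ∀ T : ℝ, 0 < T → ∃ K : ℝ, 0 ≤ K ∧ ∀ (N : ℕ) (τ : ℝ),
      0 ≤ τ →
      ∫ x, (∫ t in Set.Ioc (0 : ℝ) τ,
          Literature.MathematicalPhysics.KineticTheory.OddSectorLocality.currentForecast ω₂ lam β γ T N t x) ^ 2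
        ∂(Literature.MathematicalPhysics.KineticTheory.OddSectorLocality.gibbsWeight ω₂ lam β γ T N) ≤
      K * (N : ℝ) * τ ^ 2 *
        ∫ x, Real.exp (-((Literature.MathematicalPhysics.KineticTheory.HeatConduction.pinnedChain ω₂ lam β γ).hamiltonian N x) / T)
          ∂MeasureTheory.volume :=
  fun _ _ _ γ hω hl hβ hγ _ hT => exists_const_integral_sq_horizonCorrector_le (γ := γ) hω hl hβ hγ hT

end Summit.AtomisticToContinuum.FouriersLaw.Theorems.OddSectorIrreversibility
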